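import Mathlib
import Summits.Ventures.PercRepro2.Defs
import Summits.Ventures.PercRepro2.Graph
import Summits.Ventures.PercRepro2.OneColourSwitch
import Summits.Ventures.PercRepro2.RegionHubSign
import Summits.Ventures.PercRepro2.SideSwitch
import Summits.Ventures.PercRepro2.SideSwitchFibre
import Summits.Ventures.PercRepro2.SideSwitchClosed
import Summits.Ventures.PercRepro2.SideSwitchComps
import Summits.Ventures.PercRepro2.M9NoPocketDefs
import Summits.Ventures.PercRepro2.M9NoPocketWorld
import Summits.Ventures.PercRepro2.M9NoPocketWorldD
import Summits.Ventures.PercRepro2.M9NoPocketCompl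
import Summits.Ventures.PercRepro2.M9PsiOneDefs

/-!
# Free blocks and the `Y`-link (blind cell PercRepro2, p3 g35, 2026-08-29;
`proofs/P3-NPHDR.md` §5(a))

A FREE block of `G − d` (a block containing no neighbour of `d`) is entered and left only through
`r` and `s`: an open edge from a free block on the `Y` side to a vertex outside the block ends in
`r` or `s` (`free_block_exit`).  Hence a free block on the `Y` side contributes to `r ~_Y s`
exactly when it LINKS `r` and `s` inside itself (`LinksIn`): a linking free block on the `Y` side
gives the link (`conn_rs_of_linksIn`), and switching a NON-linking free block to the `W` side
does not change `r ~_Y s` (`conn_rs_insert_free_iff`).  This is the link lemma (a) of the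
unit-coordinate proof of THEOREMS RK-NP / 2EXHD-NP, for type-E points.  Own work; std axioms.
-/

namespace Summit.Ventures.PercRepro2

namespace NoPocket

open Finset Classical RegionHub OneColourSwitch SideSwitch

variable {V : Type*} {E : Type*}

section Defs

variable (ends : E → Sym2 V)

/-- A free block: no edge joins `d` to the block. -/
def Free (d : V) (C : Finset V) : Prop := ∀ e, ∀ y ∈ C, ends e ≠ s(d, y)

/-- The block links `r` and `s` inside `C ∪ {r, s}` (in the colouring `ρ`). -/
def LinksIn (ρ : Config E) (r s : V) (C : Finset V) : Prop :=
  Conn ends (restrictTo ends ρ (↑C ∪ {r, s})) r s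

end Defs

section Facts

variable [Fintype V] [DecidableEq V] [Fintype E] [DecidableEq E] {ends : E → Sym2 V}

omit [Fintype V] [DecidableEq V] [Fintype E] [DecidableEq E] in
/-- `restrictTo` is monotone in the vertex set. -/
lemma restrictTo_mono_set {ω : Config E} {S S' : Set V} (h : S ⊆ S') :
    restrictTo ends ω S ≤ restrictTo ends ω S' := by
  intro e
  unfold restrictTo
  by_cases he : e ∈ within ends S
  · obtain ⟨x, hx, y, hy, hends⟩ := he
    rw [if_pos ⟨x, hx, y, hy, hends⟩, if_pos ⟨x, h hx, y, h hy, hends⟩]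
  · rw [if_neg he]
    simp

omit [Fintype V] [DecidableEq V] [Fintype E] [DecidableEq E] in
/-- `restrictTo` lies below the colouring. -/
lemma restrictTo_le_self {ω : Config E} (S : Set V) : restrictTo ends ω S ≤ ω := by
  intro e
  unfold restrictTo
  split_ifs
  · exact le_rfl
  · simp

/-- A block vertex of an unswitched block is not in the switched union. -/
lemma notMem_unionT_of_mem_block {p q r s d : V} {ρ : Config E} (hρ : ρ ∈ RepD ends p q r s d)
    {T : Finset (Finset V)} (hT : T ⊆ blocks ends d r s ρ) {C : Finset V}
    (hC : C ∈ blocks ends d r s ρ) (hCT : C ∉ T) {y : V} (hy : y ∈ C) : y ∉ unionT T :=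
  fun h => hCT (block_mem_of_mem_unionT hρ hT hC hy h)

/-- `r` and `s` are not in the switched union. -/
lemma r_notMem_unionT {p q r s d : V} {ρ : Config E} (_hρ : ρ ∈ RepD ends p q r s d)
    {T : Finset (Finset V)} (hT : T ⊆ blocks ends d r s ρ) :
    r ∉ unionT T ∧ s ∉ unionT T := by
  constructor
  · intro h
    exact (mem_A0.1 (unionT_subset_A0 (ends := endsD ends d) hT h)).2.1 rfl
  · intro h
    exact (mem_A0.1 (unionT_subset_A0 (ends := endsD ends d) hT h)).2.2 rfl

/-- An edge inside `C ∪ {r, s}` of an unswitched block keeps the colour of the representative. -/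
lemma assignX_eq_of_within {p q r s d : V} {ρ : Config E} (hρ : ρ ∈ RepD ends p q r s d)
    (hr : d ≠ r) (hs : d ≠ s) {x : Finset (Finset V) × Finset E} (hT : x.1 ⊆ blocks ends d r s ρ)
    (hx2 : x.2 = ∅) {C : Finset V} (hC : C ∈ blocks ends d r s ρ) (hCx : C ∉ x.1) {e : E}
    (he : e ∈ within ends (↑C ∪ {r, s} : Set V)) : assignX ends x ρ e = ρ e := by
  obtain ⟨u, hu, v, hv, hends⟩ := he
  have hnt : e ∉ touches ends (↑(unionT x.1) : Set V) := by
    rintro ⟨w, hw, z, hwz⟩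
    have hw' : w ∈ unionT x.1 := Finset.mem_coe.1 hw
    have hwe : w ∈ ends e := by rw [hwz]; exact Sym2.mem_mk_left _ _
    rw [hends, Sym2.mem_iff] at hwe
    obtain ⟨hrT, hsT⟩ := r_notMem_unionT hρ hT
    rcases hwe with rfl | rfl
    · rcases hu with hu | hu
      · exact notMem_unionT_of_mem_block hρ hT hC hCx (Finset.mem_coe.1 hu) hw'
      · rcases hu with rfl | rfl
        · exact hrT hw'
        · exact hsT hw'
    · rcases hv with hv | hv
      · exact notMem_unionT_of_mem_block hρ hT hC hCx (Finset.mem_coe.1 hv) hw'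
      · rcases hv with rfl | rfl
        · exact hrT hw'
        · exact hsT hw'
  simp only [assignX, flipTouch, flipF, hx2, Finset.notMem_empty, hnt, if_false]

/-- A `Y`-side linking free block gives `r ~_Y s`. -/
theorem conn_rs_of_linksIn {p q r s d : V} {ρ : Config E} (hρ : ρ ∈ RepD ends p q r s d)
    (hr : d ≠ r) (hs : d ≠ s) {x : Finset (Finset V) × Finset E} (hT : x.1 ⊆ blocks ends d r s ρ)
    (hx2 : x.2 = ∅) {C : Finset V} (hC : C ∈ blocks ends d r s ρ) (hCx : C ∉ x.1)
    (hL : LinksIn ends ρ r s C) : Conn ends (assignX ends x ρ) r s := by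
  refine conn_mono (ω := restrictTo ends ρ (↑C ∪ {r, s})) ?_ hL
  intro e
  unfold restrictTo
  by_cases he : e ∈ within ends (↑C ∪ {r, s} : Set V)
  · rw [if_pos he, assignX_eq_of_within hρ hr hs hT hx2 hC hCx he]
  · rw [if_neg he]
    simp

/-- **The exits of a free block.**  An open edge of an assignment from a vertex of a free
unswitched block to a vertex outside the block ends in `r` or `s`. -/
theorem free_block_exit {p q r s d : V} {ρ : Config E} (hρ : ρ ∈ RepD ends p q r s d)
    (hr : d ≠ r) (hs : d ≠ s) {x : Finset (Finset V) × Finset E} (hT : x.1 ⊆ blocks ends d r s ρ)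
    (hx2 : x.2 = ∅) {C : Finset V} (hC : C ∈ blocks ends d r s ρ) (hCx : C ∉ x.1)
    (hfree : Free ends d C) {e : E} {u v : V} (hends : ends e = s(u, v)) (hu : u ∈ C)
    (hv : v ∉ C) (he : assignX ends x ρ e = true) : v = r ∨ v = s := by
  by_cases hvr : v = r
  · exact Or.inl hvr
  by_cases hvs : v = s
  · exact Or.inr hvs
  exfalso
  have hvd : v ≠ d := by
    rintro rfl
    exact hfree e u hu (by rw [hends, Sym2.eq_swap])
  have hud : u ≠ d := (block_vertex_ne hρ hC hu hr hs).2.2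
  have hnd : d ∉ ends e := by
    rw [hends]
    intro h
    rcases Sym2.mem_iff.1 h with h | h
    · exact hud h.symm
    · exact hvd h.symm
  -- `v` is not sided in `G − d`: else it would lie in the block `C`
  have hvA : v ∉ A0 (endsD ends d) r s ρ := by
    intro hvA
    have hcl := closedIn_of_mem_comps (ends := endsD ends d) hC
    rw [sided_eq_coe_A0] at hcl
    exact hv (Finset.mem_coe.1 (hcl e u v (by rw [endsD_of_notMem hnd]; exact hends)
      (Finset.mem_coe.2 hu) (Finset.mem_coe.2 hvA)))
  -- the edge is unchanged by the assignment
  have hnt : e ∉ touches ends (↑(unionT x.1) : Set V) := by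
    rintro ⟨w, hw, z, hwz⟩
    have hw' : w ∈ unionT x.1 := Finset.mem_coe.1 hw
    have hwe : w ∈ ends e := by rw [hwz]; exact Sym2.mem_mk_left _ _
    rw [hends, Sym2.mem_iff] at hwe
    rcases hwe with rfl | rfl
    · exact notMem_unionT_of_mem_block hρ hT hC hCx hu hw'
    · exact hvA (unionT_subset_A0 (ends := endsD ends d) hT hw')
  have hρe : ρ e = true := by
    have := he
    simp only [assignX, flipTouch, flipF, hx2, Finset.notMem_empty, hnt, if_false] at this
    exact this
  -- so `v` lies in the `Y`-world of `G − d`, hence is `r`, `s` or sided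
  have hvK : v ∈ K2 (endsD ends d) r s ρ :=
    mem_K2_of_open (mem_K2_endsD_of_block hρ hC hu) hρe (by rw [endsD_of_notMem hnd]; exact hends)
  rcases mem_A0_of_mem_K2_endsD hvK with h | h | h
  · exact hvr h
  · exact hvs h
  · exact hvA h

omit [Fintype V] [Fintype E] in
/-- Switching a block to the `W` side changes only the edges touching it. -/
lemma assignX_insert_eq_of_not_touches {ρ : Config E} {x : Finset (Finset V) × Finset E}
    {C : Finset V} {e : E} (he : e ∉ touches ends (↑C : Set V)) :
    assignX ends (insert C x.1, x.2) ρ e = assignX ends x ρ e := by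
  have hiff : e ∈ touches ends (↑(unionT (insert C x.1)) : Set V) ↔
      e ∈ touches ends (↑(unionT x.1) : Set V) := by
    constructor
    · rintro ⟨w, hw, z, hwz⟩
      obtain ⟨C', hC', hwC'⟩ := mem_unionT.1 (Finset.mem_coe.1 hw)
      rcases Finset.mem_insert.1 hC' with rfl | hC'
      · exact absurd ⟨w, Finset.mem_coe.2 hwC', z, hwz⟩ he
      · exact ⟨w, Finset.mem_coe.2 (mem_unionT.2 ⟨C', hC', hwC'⟩), z, hwz⟩
    · rintro ⟨w, hw, z, hwz⟩
      obtain ⟨C', hC', hwC'⟩ := mem_unionT.1 (Finset.mem_coe.1 hw)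
      exact ⟨w, Finset.mem_coe.2 (mem_unionT.2 ⟨C', Finset.mem_insert_of_mem hC', hwC'⟩), z, hwz⟩
  simp only [assignX, flipTouch]
  by_cases h : e ∈ touches ends (↑(unionT x.1) : Set V)
  · rw [if_pos (hiff.2 h), if_pos h]
  · rw [if_neg (fun h' => h (hiff.1 h')), if_neg h]

/-- The `Y`-world of the assignment with `C` switched avoids `C` (same-type representative). -/
lemma notMem_C_of_mem_K2_insert {p q r s d : V} (hnp : NoPocketAt ends d r s)
    {ρ : Config E} (hρ : ρ ∈ RepD ends p q r s d) (hr : d ≠ r) (hs : d ≠ s)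
    (hsame : ∀ C' ∈ blocks ends d r s ρ, ¬ hasW ends d ρ C')
    {x : Finset (Finset V) × Finset E} (hT : x.1 ⊆ blocks ends d r s ρ) (hx2 : x.2 = ∅)
    {C : Finset V} (hC : C ∈ blocks ends d r s ρ) {z : V}
    (hz : z ∈ K2 ends r s (assignX ends (insert C x.1, x.2) ρ)) : z ∉ C := by
  intro hzC
  have hT' : (insert C x.1, x.2).1 ⊆ blocks ends d r s ρ := Finset.insert_subset hC hT
  have hF' : (insert C x.1, x.2).2 ⊆ Tset ends d r s := by
    show x.2 ⊆ _
    rw [hx2]; exact Finset.empty_subset _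
  have hL : srcY ends d r s ρ (insert C x.1, x.2) →
      ∀ C' ∈ (insert C x.1, x.2).1, ¬ hasW ends d ρ C' :=
    fun _ C' hC' => hsame C' (hT' hC')
  rw [K2_assignX hnp hρ hT' hF' hr hs hL] at hz
  rcases hz with hz | ⟨rfl, _⟩
  · rw [K2_endsD_assignX hρ hT' hF'] at hz
    exact hz.2 (Finset.mem_coe.2 (mem_unionT.2 ⟨C, Finset.mem_insert_self _ _, hzC⟩))
  · exact (block_vertex_ne hρ hC hzC hr hs).2.2 rfl

/-- `r` and `s` are not block vertices. -/
lemma r_notMem_block {p q r s d : V} {ρ : Config E} (_hρ : ρ ∈ RepD ends p q r s d)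
    {C : Finset V} (hC : C ∈ blocks ends d r s ρ) : r ∉ C ∧ s ∉ C := by
  constructor
  · intro h
    exact (mem_A0.1 (subset_A0_of_mem_comps (ends := endsD ends d) hC h)).2.1 rfl
  · intro h
    exact (mem_A0.1 (subset_A0_of_mem_comps (ends := endsD ends d) hC h)).2.2 rfl

/-- **Switching a free block to the `W` side cannot create a `Y`-link** (the `Y`-world of the
switched assignment avoids the block; same-type representative). -/
theorem conn_rs_of_insert {p q r s d : V} (hnp : NoPocketAt ends d r s) {ρ : Config E}
    (hρ : ρ ∈ RepD ends p q r s d) (hr : d ≠ r) (hs : d ≠ s)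
    (hsame : ∀ C' ∈ blocks ends d r s ρ, ¬ hasW ends d ρ C')
    {x : Finset (Finset V) × Finset E} (hT : x.1 ⊆ blocks ends d r s ρ) (hx2 : x.2 = ∅)
    {C : Finset V} (hC : C ∈ blocks ends d r s ρ)
    (h : Conn ends (assignX ends (insert C x.1, x.2) ρ) r s) : Conn ends (assignX ends x ρ) r s := by
  have key : s ∈ {z | z ∈ K2 ends r s (assignX ends (insert C x.1, x.2) ρ) ∧
      Conn ends (assignX ends x ρ) r z} := by
    refine mem_of_conn_of_closed (ends := ends) (ω := assignX ends (insert C x.1, x.2) ρ) ?_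
      ⟨r_mem_K2 r s _, conn_refl _ _ _⟩ h
    rintro u ⟨huK, hu⟩ v hadj
    obtain ⟨_, e, he, hends⟩ := openGraph_adj.1 hadj
    have hvK : v ∈ K2 ends r s (assignX ends (insert C x.1, x.2) ρ) := mem_K2_of_open huK he hends
    have hnt : e ∉ touches ends (↑C : Set V) := by
      rintro ⟨w, hw, z, hwz⟩
      have hwe : w ∈ ends e := by rw [hwz]; exact Sym2.mem_mk_left _ _
      rw [hends, Sym2.mem_iff] at hwe
      rcases hwe with rfl | rfl
      · exact notMem_C_of_mem_K2_insert hnp hρ hr hs hsame hT hx2 hC huK (Finset.mem_coe.1 hw)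
      · exact notMem_C_of_mem_K2_insert hnp hρ hr hs hsame hT hx2 hC hvK (Finset.mem_coe.1 hw)
    have he2 : assignX ends x ρ e = true := by
      rw [← assignX_insert_eq_of_not_touches (x := x) (ρ := ρ) hnt]; exact he
    exact ⟨hvK, conn_trans hu (conn_of_openAdj ⟨e, he2, hends⟩)⟩
  exact key.2

/-- The colouring with the edges touching `C` closed. -/
noncomputable def closeTouch (ends' : E → Sym2 V) (C : Finset V) (ω : Config E) : Config E :=
  fun e => if e ∈ touches ends' (↑C : Set V) then false else ω e

omit [Fintype V] [DecidableEq V] [Fintype E] [DecidableEq E] in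
/-- A `Y`-path of `closeTouch C ω` from `r ∉ C` stays outside `C`. -/
lemma notMem_of_conn_closeTouch {ω : Config E} {C : Finset V} {r z : V} (hr : r ∉ C)
    (h : Conn ends (closeTouch ends C ω) r z) : z ∉ C := by
  have key : z ∈ {y | y ∉ C} := by
    refine mem_of_conn_of_closed (ends := ends) (ω := closeTouch ends C ω) ?_ hr h
    rintro u hu v hadj
    obtain ⟨_, e, he, hends⟩ := openGraph_adj.1 hadj
    intro hv
    have ht : e ∈ touches ends (↑C : Set V) := ⟨v, Finset.mem_coe.2 hv, u, by rw [hends, Sym2.eq_swap]⟩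
    simp [closeTouch, ht] at he
  exact key

/-- **Switching a NON-linking free block to the `W` side cannot destroy a `Y`-link**: the
`Y`-path can be re-routed around the block, which is entered and left only through `r, s`. -/
theorem conn_rs_insert_of_conn {p q r s d : V} {ρ : Config E} (hρ : ρ ∈ RepD ends p q r s d)
    (hr : d ≠ r) (hs : d ≠ s) {x : Finset (Finset V) × Finset E} (hT : x.1 ⊆ blocks ends d r s ρ)
    (hx2 : x.2 = ∅) {C : Finset V} (hC : C ∈ blocks ends d r s ρ) (hCx : C ∉ x.1)
    (hfree : Free ends d C) (hnl : ¬ LinksIn ends ρ r s C)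
    (h : Conn ends (assignX ends x ρ) r s) : Conn ends (assignX ends (insert C x.1, x.2) ρ) r s := by
  obtain ⟨hrC, hsC⟩ := r_notMem_block hρ hC
  -- the colouring with the edges at `C` closed lies below the switched assignment
  have hle : closeTouch ends C (assignX ends x ρ) ≤ assignX ends (insert C x.1, x.2) ρ := by
    intro e
    by_cases ht : e ∈ touches ends (↑C : Set V)
    · simp [closeTouch, ht]
    · simp only [closeTouch, ht, if_false]
      rw [assignX_insert_eq_of_not_touches (x := x) (ρ := ρ) ht]
  by_cases hcs : Conn ends (closeTouch ends C (assignX ends x ρ)) r s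
  · exact conn_mono hle hcs
  exfalso
  -- the closure set: the `Y`-cluster of `r` avoiding `C`, plus the part of `C` attached to `r`
  have key : s ∈ {z | Conn ends (closeTouch ends C (assignX ends x ρ)) r z ∨
      (z ∈ C ∧ Conn ends (restrictTo ends (assignX ends x ρ) (↑C ∪ {r})) r z)} := by
    refine mem_of_conn_of_closed (ends := ends) (ω := assignX ends x ρ) ?_
      (Or.inl (conn_refl _ _ _)) h
    rintro u (hu | ⟨huC, hu⟩) v hadj
    · -- `u` outside `C`
      obtain ⟨_, e, he, hends⟩ := openGraph_adj.1 hadj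
      have huC : u ∉ C := notMem_of_conn_closeTouch hrC hu
      by_cases hvC : v ∈ C
      · -- an open edge from outside into `C`: `u` is `r` or `s`
        rcases free_block_exit hρ hr hs hT hx2 hC hCx hfree (by rw [hends, Sym2.eq_swap]) hvC huC he
          with rfl | rfl
        · right
          refine ⟨hvC, conn_of_openAdj ⟨e, ?_, hends⟩⟩
          unfold restrictTo
          rw [if_pos ⟨u, Or.inr rfl, v, Or.inl (Finset.mem_coe.2 hvC), hends⟩]
          exact he
        · exact (hcs hu).elim
      · left
        have ht : e ∉ touches ends (↑C : Set V) := by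
          rintro ⟨w, hw, z, hwz⟩
          have hwe : w ∈ ends e := by rw [hwz]; exact Sym2.mem_mk_left _ _
          rw [hends, Sym2.mem_iff] at hwe
          rcases hwe with rfl | rfl
          · exact huC (Finset.mem_coe.1 hw)
          · exact hvC (Finset.mem_coe.1 hw)
        have he' : closeTouch ends C (assignX ends x ρ) e = true := by
          simp only [closeTouch, ht, if_false]; exact he
        exact conn_trans hu (conn_of_openAdj ⟨e, he', hends⟩)
    · -- `u` in the `r`-part of `C`
      obtain ⟨_, e, he, hends⟩ := openGraph_adj.1 hadj
      by_cases hvC : v ∈ C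
      · right
        refine ⟨hvC, conn_trans hu (conn_of_openAdj ⟨e, ?_, hends⟩)⟩
        unfold restrictTo
        rw [if_pos ⟨u, Or.inl (Finset.mem_coe.2 huC), v, Or.inl (Finset.mem_coe.2 hvC), hends⟩]
        exact he
      · rcases free_block_exit hρ hr hs hT hx2 hC hCx hfree hends huC hvC he with rfl | rfl
        · exact Or.inl (conn_refl _ _ _)
        · -- `u ~ s` inside `C ∪ {r, s}`: the block would link
          exfalso
          apply hnl
          have h1 : Conn ends (restrictTo ends (assignX ends x ρ) (↑C ∪ {r, v})) r u :=
            conn_mono (restrictTo_mono_set (by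
              intro z hz
              rcases hz with hz | hz
              · exact Or.inl hz
              · rw [Set.mem_singleton_iff] at hz
                exact Or.inr (Or.inl hz))) hu
          have h2 : Conn ends (restrictTo ends (assignX ends x ρ) (↑C ∪ {r, v})) u v := by
            refine conn_of_openAdj ⟨e, ?_, hends⟩
            unfold restrictTo
            rw [if_pos ⟨u, Or.inl (Finset.mem_coe.2 huC), v, Or.inr (Or.inr rfl), hends⟩]
            exact he
          have h3 := conn_trans h1 h2
          -- the restrictions of the assignment and of the representative agree on `C ∪ {r, s}`
          have heq : restrictTo ends (assignX ends x ρ) (↑C ∪ {r, v}) =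
              restrictTo ends ρ (↑C ∪ {r, v}) := by
            funext e'
            unfold restrictTo
            by_cases he' : e' ∈ within ends (↑C ∪ {r, v} : Set V)
            · rw [if_pos he', if_pos he', assignX_eq_of_within hρ hr hs hT hx2 hC hCx he']
            · rw [if_neg he', if_neg he']
          rw [heq] at h3
          exact h3
  rcases key with hk | ⟨hsC', _⟩
  · exact hcs hk
  · exact hsC hsC'

/-- **The link lemma for a non-linking free block**: switching it does not change `r ~_Y s`. -/
theorem conn_rs_insert_free_iff {p q r s d : V} (hnp : NoPocketAt ends d r s) {ρ : Config E}
    (hρ : ρ ∈ RepD ends p q r s d) (hr : d ≠ r) (hs : d ≠ s)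
    (hsame : ∀ C' ∈ blocks ends d r s ρ, ¬ hasW ends d ρ C')
    {x : Finset (Finset V) × Finset E} (hT : x.1 ⊆ blocks ends d r s ρ) (hx2 : x.2 = ∅)
    {C : Finset V} (hC : C ∈ blocks ends d r s ρ) (hCx : C ∉ x.1)
    (hfree : Free ends d C) (hnl : ¬ LinksIn ends ρ r s C) :
    Conn ends (assignX ends (insert C x.1, x.2) ρ) r s ↔ Conn ends (assignX ends x ρ) r s :=
  ⟨conn_rs_of_insert hnp hρ hr hs hsame hT hx2 hC,
    conn_rs_insert_of_conn hρ hr hs hT hx2 hC hCx hfree hnl⟩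

end Facts

end NoPocket

end Summit.Ventures.PercRepro2
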